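import Summits.AtomisticToContinuum.FouriersLaw.Theorems.BondHeatUncertaintyExtensiveSnapshotIrreversibilityEnergyWindowSkeletonArrivalIntegrability
import Summits.AtomisticToContinuum.FouriersLaw.Theorems.BondHeatUncertaintyExtensiveSnapshotIrreversibilityEnergyWindowSkeletonMixedVariation

/-!
# Energy window, part W-5 — the four `L¹` conditions of the DEPARTURE identity for a bounded `C¹`
observable with bounded derivative, from (JM)/(JMˣ)₁/(JMˣ)₂ (all PROVED) and the mixed variation (W-4)

Lineage `stmt-AtomisticToContinuum-9121` (`ExtensiveSnapshotIrreversibility`), K_fix half, leaf S3;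
cell decomp-a2c, lens «grading / quantitative ladder», generation 81, part W «Glues», file 5.
For the DEPARTURE identity of part T-b (`integral_mul_skelWeightDep_eq`: level `m`, `κ > 0`, bath
momentum `b`, starting point `z`, bath temperatures `T_L, T_R ∈ [T/2, 2T]`, `0 ≤ s ≤ 1`) — whose
control direction is the RANDOM departure vector `e(x) = V(x) = coordV (∂_z E(z, r, x)[(0, e_b)])`
— and an observable `g ∈ C¹` with `|g| ≤ M₀`, `|Dg(w)v| ≤ L‖v‖`, the four integrability
hypotheses `hGu`, `hxGu`, `hdGu`, `hGdu` HOLD (§6).  Ingredients: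
* §2 moments of the starting-point variation along the Brownian path,
  `E‖∂_z E[v]‖^q ≤ (C‖v‖e^{εH(z)})^q` on the window (W-4 §3 pathwise Grönwall bound
  `norm_fderiv_skelFlowMapAt_left_le` + T-a2's engine `lintegral_rpow_le_of_le_mul_exp_integral`;
  this is the (JM) `FlowJacobianMoment` mechanism — R/S′ decl, PROVED `flowJacobianMoment` — for a
  general direction and unequal temperatures);
* §3 joint measurability / smoothness of `∂_z E[v]` in (skeleton, remainder) (T-b
  `measurable_skelFlowMapAt_uncurry`, R `contDiff_skelFlowMapAt_uncurry` — GENUINE derivatives) and of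
  the mixed variation `∂_x ∂_z E` (`measurable_fderiv_apply_of_param`);
* §4 `‖∂_z E[v]‖^n, ‖∂_{b_j}∂_z E[v]‖^n ∈ L¹` (§2 and W-4 `skeletonMixedVariationMoments`);
* §5 pointwise sizes of the departure data: `Σ_a|V_a| ≤ K‖∂_zE(0,e_b)‖`,
  `|∂_v V_k| ≤ ‖∂_v∂_zE(0,e_b)‖` (W-1 `fderiv_coordV_comp`), hence W-1's generic field bounds
  `abs_skelFieldGen_le` / `abs_fderiv_skelFieldGen_le` specialised to `e = V`;
* §6 domination by Young's inequality with the moments of `F_l = ‖DE b_l‖` ((JMˣ)₁, T-a2),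
  `S_l = ‖∂_jDE b_l‖` ((JMˣ)₂, tree theorem `skeletonSecondVariationMoments`, V-c), `Z = ‖∂_zE(0,e_b)‖`
  (§4) and `Mx = ‖∂_j∂_zE(0,e_b)‖` (W-4), and the second moment of a skeleton coordinate (W-2).
Constants are irrelevant (finiteness at fixed `m, κ`).  No instance / notation / option; no proof
holes.  References: D. Nualart, The Malliavin Calculus and Related Topics (2006), Prop. 1.3.1
[cite: Nualart2006, Prop 1.3.1]; Cuneo–Eckmann–Hairer–Rey-Bellet (2018) §3 eq. (3.4)
[cite: CuneoEckmannHairerReyBellet2018, §3 eq. (3.4)]. [folklore]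

**File 1 of 2** (split for the 400-line cap): this file holds §§1–3 and §5 (helpers, moments of the starting-point variation, regularity, pointwise sizes); the sequel module `…BondHeatUncertaintyExtensiveSnapshotIrreversibilityEnergyWindowSkeletonDepartureIntegrability` continues in the same namespace (all declaration names unchanged).
-/

noncomputable section

namespace Summit.AtomisticToContinuum.FouriersLaw.Theorems.ExtensiveSnapshotIrreversibility.EnergyWindow

open MeasureTheory ProbabilityTheory Filter Topology Set
open scoped ENNReal NNReal Matrix ContDiff
open Literature.MathematicalPhysics.KineticTheory.HeatConduction
open Literature.Probability.Process
open Literature.Probability.Distributions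

-- PRIVATE copies (landing lane): these helpers are `private` in `BondHeatUncertaintyExtensiveSnapshotIrreversibilityEnergyWindowSkeletonArrivalIntegrability` (dedup gate), so each consumer module carries its own private copy.
/-- Young: `a b ≤ (a² + b²)/2`. [folklore] -/
private theorem mul_le_half_sq_add_sq (a b : ℝ) : a * b ≤ (a ^ 2 + b ^ 2) / 2 := by
  nlinarith [sq_nonneg (a - b)]

/-! ## 1. Helpers -/

/-- `Σ_a |coordV v a| ≤ 2N ‖v‖` (each coordinate is bounded by the sup norm). [folklore] -/
theorem sum_abs_coordV_le_card_mul_norm {N : ℕ} (v : PhaseSpace N) :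
    ∑ a, |coordV N v a| ≤ (Fintype.card (Fin N ⊕ Fin N) : ℝ) * ‖v‖ := by
  calc ∑ a, |coordV N v a| ≤ ∑ _a : Fin N ⊕ Fin N, ‖v‖ :=
        Finset.sum_le_sum fun a _ => abs_coordV_apply_le_norm v a
    _ = _ := by rw [Finset.sum_const, Finset.card_univ, nsmul_eq_mul]

/-- Young for four factors: `a b (c d) ≤ ((a⁴ + b⁴)/2 + (c⁴ + d⁴)/2)/2`. [folklore] -/
theorem mul_mul_mul_le_young4 (a b c d : ℝ) :
    a * b * (c * d) ≤ ((a ^ 4 + b ^ 4) / 2 + (c ^ 4 + d ^ 4) / 2) / 2 := by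
  have h1 : a * b * (c * d) ≤ ((a * b) ^ 2 + (c * d) ^ 2) / 2 := mul_le_half_sq_add_sq (a * b) (c * d)
  have h2 : (a * b) ^ 2 ≤ (a ^ 4 + b ^ 4) / 2 := by nlinarith [sq_nonneg (a ^ 2 - b ^ 2)]
  have h3 : (c * d) ^ 2 ≤ (c ^ 4 + d ^ 4) / 2 := by nlinarith [sq_nonneg (c ^ 2 - d ^ 2)]
  linarith

/-- Young: `a b² ≤ (a² + b⁴)/2`. [folklore] -/
theorem mul_sq_le_half_sq_add_pow_four (a b : ℝ) : a * b ^ 2 ≤ (a ^ 2 + b ^ 4) / 2 := by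
  have h := mul_le_half_sq_add_sq a (b ^ 2)
  have h2 : (b ^ 2) ^ 2 = b ^ 4 := by ring
  rwa [h2] at h

/-! ## 2. Moments of the starting-point variation along the path -/

section Moment

variable {ω₂ lam β γ : ℝ} (hω : 0 < ω₂) (hl : 0 ≤ lam) (hβ : 0 ≤ β) (hγ : 0 ≤ γ) {N : ℕ}
  (hN : 0 < N) {T_L T_R : ℝ} (hTL : 0 < T_L) (hTR : 0 < T_R)

include hω hl hβ hγ hN hTL hTR in
/-- **Moments of the starting-point variation along the Brownian path**, for `q ≥ 1`,
`0 < θ < 1/max(T_L, T_R)`, `s ∈ [0, 1]`, every level `m`, start `z` and direction `v`: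
`E ‖∂_z X_s^{m}(z, R_m B, Ξ_m B)[v]‖^q ≤ ‖v‖^q exp(qA₀ + q²A₁²/(4θ) + θγ(T_L+T_R)) e^{θH(z)}`
(W-4 §3 + T-a2's moment engine; the (JM) mechanism). [cite: CuneoEckmannHairerReyBellet2018, §3 eq. (3.4)] -/
theorem lintegral_rpow_norm_fderiv_skelFlowMapAt_left_le {q : ℝ} (hq : 1 ≤ q) {θ : ℝ}
    (hθ : 0 < θ) (hθ' : θ < 1 / max T_L T_R) {s : ℝ} (hs : s ∈ Icc (0 : ℝ) 1) (m : ℕ)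
    (z v : PhaseSpace N) :
    ∫⁻ wp, ENNReal.ofReal ‖fderiv ℝ
        (fun z' => skelFlowMapAt ω₂ lam β γ N T_L T_R s m z' (pairRem m wp) (pairSkel m wp)) z v‖ ^ q
        ∂wienerPair ≤
      ENNReal.ofReal (‖v‖ ^ q *
        (Real.exp (q * driftA₀ ω₂ γ N + q ^ 2 * driftA₁ lam β N ^ 2 / (4 * θ) +
            θ * γ * (T_L + T_R)) *
          Real.exp (θ * (pinnedChain ω₂ lam β γ).hamiltonian N z))) := by
  have hA₀ := driftA₀_nonneg hω.le hγ N
  refine lintegral_rpow_le_of_le_mul_exp_integral hω hl hβ hγ hN hTL hTR hq hθ hθ' hs z hA₀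
    (norm_nonneg v) (fun wp => norm_nonneg _) fun wp => ?_
  have h := norm_fderiv_skelFlowMapAt_left_le hω hl hβ hγ N T_L T_R hs m z (pairRem m wp)
    (pairSkel m wp) v
  have hI : ∫ t in (0 : ℝ)..s, (driftA₀ ω₂ γ N + driftA₁ lam β N *
        √((pinnedChain ω₂ lam β γ).hamiltonian N
          (skelFlowMapAt ω₂ lam β γ N T_L T_R t m z (pairRem m wp) (pairSkel m wp)))) =
      ∫ t in (0 : ℝ)..s, (driftA₀ ω₂ γ N + driftA₁ lam β N *
        √((pinnedChain ω₂ lam β γ).hamiltonian N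
          ((pinnedChain ω₂ lam β γ).solMap N T_L T_R t z (pairPath wp)))) := by
    refine intervalIntegral.integral_congr fun u hu => ?_
    have hu' : u ∈ Icc (0 : ℝ) 1 := by
      rw [uIcc_of_le hs.1] at hu
      exact ⟨hu.1, hu.2.trans hs.2⟩
    simp only [pinnedChain_solMap_eq_skelFlowMapAt hω hl hβ hγ N T_L T_R hu' m z wp]
  rw [hI] at h
  exact h

end Moment

/-- ★ **(JMᶻ) starting-point variation moments on the temperature window** `T_L, T_R ∈ [T/2, 2T]`:
for `q ≥ 1`, `ε > 0` there is `C` with `E‖∂_z X_s^m[v]‖^q ≤ (C ‖v‖ e^{εH(z)})^q` for all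
`s ∈ [0,1]`, levels `m`, starts `z`, directions `v` (the (JM) `FlowJacobianMoment` mechanism —
PROVED in the tree as `flowJacobianMoment` for `v = (0,e_b)`, equal temperatures).
[cite: CuneoEckmannHairerReyBellet2018, §3 eq. (3.4)] -/
theorem skeletonStartVariationMoments :
    ∀ ω₂ lam β γ : ℝ, 0 < ω₂ → 0 < lam → 0 < β → 0 < γ → ∀ T : ℝ, 0 < T →
      ∀ N : ℕ, 0 < N → ∀ q ε : ℝ, 1 ≤ q → 0 < ε → ∃ C : ℝ,
        ∀ T_L T_R : ℝ, T / 2 ≤ T_L → T_L ≤ 2 * T → T / 2 ≤ T_R → T_R ≤ 2 * T →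
          ∀ s : ℝ, 0 ≤ s → s ≤ 1 → ∀ (m : ℕ) (z v : PhaseSpace N),
            ∫⁻ wp, ENNReal.ofReal ‖fderiv ℝ
                (fun z' => skelFlowMapAt ω₂ lam β γ N T_L T_R s m z' (pairRem m wp) (pairSkel m wp))
                  z v‖ ^ q ∂wienerPair ≤
              ENNReal.ofReal ((C * ‖v‖ *
                Real.exp (ε * (pinnedChain ω₂ lam β γ).hamiltonian N z)) ^ q) := by
  intro ω₂ lam β γ hω hl hβ hγ T hT N hN q ε hq hε
  have hq0 : 0 ≤ q := zero_le_one.trans hq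
  set θ : ℝ := min ε (1 / (4 * T)) with hθdef
  have hθ : 0 < θ := lt_min hε (by positivity)
  have hθε : θ ≤ ε := min_le_left _ _
  have hθT : θ ≤ 1 / (4 * T) := min_le_right _ _
  clear_value θ
  set A₀ := driftA₀ ω₂ γ N with hA₀
  set A₁ := driftA₁ lam β N with hA₁
  refine ⟨Real.exp (A₀ + q * A₁ ^ 2 / (4 * θ) + 4 * θ * γ * T), ?_⟩
  intro T_L T_R hTL1 hTL2 hTR1 hTR2 s hs0 hs1 m z v
  have hTL : 0 < T_L := by linarith
  have hTR : 0 < T_R := by linarith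
  have hθ' : θ < 1 / max T_L T_R := by
    have hmax : max T_L T_R ≤ 2 * T := max_le hTL2 hTR2
    have h1 : 1 / (2 * T) ≤ 1 / max T_L T_R :=
      one_div_le_one_div_of_le (lt_max_of_lt_left hTL) hmax
    have h2 : 1 / (4 * T) < 1 / (2 * T) := one_div_lt_one_div_of_lt (by positivity) (by linarith)
    linarith
  have hmain := lintegral_rpow_norm_fderiv_skelFlowMapAt_left_le hω hl.le hβ.le hγ.le hN hTL hTR
    hq hθ hθ' ⟨hs0, hs1⟩ m z v
  refine hmain.trans (ENNReal.ofReal_le_ofReal ?_)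
  rw [← hA₀, ← hA₁]
  have hH0 : 0 ≤ (pinnedChain ω₂ lam β γ).hamiltonian N z :=
    pinnedChain_hamiltonian_nonneg hω.le hl.le hβ.le γ N z
  set H := (pinnedChain ω₂ lam β γ).hamiltonian N z with hH
  have hv := norm_nonneg v
  have h2 : Real.exp (q * A₀ + q ^ 2 * A₁ ^ 2 / (4 * θ) + θ * γ * (T_L + T_R)) ≤
      Real.exp (A₀ + q * A₁ ^ 2 / (4 * θ) + 4 * θ * γ * T) ^ q := by
    rw [← Real.exp_mul, Real.exp_le_exp]
    have h21 : θ * γ * (T_L + T_R) ≤ θ * γ * (4 * T) :=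
      mul_le_mul_of_nonneg_left (by linarith) (mul_nonneg hθ.le hγ.le)
    have h22 : θ * γ * (4 * T) ≤ θ * γ * (4 * T) * q :=
      le_mul_of_one_le_right (by positivity) hq
    have h23 : (A₀ + q * A₁ ^ 2 / (4 * θ) + 4 * θ * γ * T) * q =
        q * A₀ + q ^ 2 * A₁ ^ 2 / (4 * θ) + θ * γ * (4 * T) * q := by ring
    linarith
  have h3 : Real.exp (θ * H) ≤ Real.exp (ε * H) ^ q := by
    rw [← Real.exp_mul, Real.exp_le_exp]
    have h31 : θ * H ≤ ε * H := mul_le_mul_of_nonneg_right hθε hH0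
    have h32 : ε * H ≤ ε * H * q := le_mul_of_one_le_right (by positivity) hq
    linarith
  have hE1 : 0 ≤ Real.exp (A₀ + q * A₁ ^ 2 / (4 * θ) + 4 * θ * γ * T) ^ q :=
    Real.rpow_nonneg (Real.exp_pos _).le q
  calc ‖v‖ ^ q * (Real.exp (q * A₀ + q ^ 2 * A₁ ^ 2 / (4 * θ) + θ * γ * (T_L + T_R)) *
        Real.exp (θ * H))
      ≤ ‖v‖ ^ q * (Real.exp (A₀ + q * A₁ ^ 2 / (4 * θ) + 4 * θ * γ * T) ^ q *
          Real.exp (ε * H) ^ q) :=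
        mul_le_mul_of_nonneg_left (mul_le_mul h2 h3 (Real.exp_pos _).le hE1) (Real.rpow_nonneg hv q)
    _ = (Real.exp (A₀ + q * A₁ ^ 2 / (4 * θ) + 4 * θ * γ * T) * ‖v‖ * Real.exp (ε * H)) ^ q := by
        rw [← Real.mul_rpow (Real.exp_pos _).le (Real.exp_pos _).le,
          ← Real.mul_rpow hv (mul_nonneg (Real.exp_pos _).le (Real.exp_pos _).le)]
        congr 1
        ring

/-! ## 3. Smoothness and measurability of the starting-point variation and of the mixed variation -/

section DepReg

variable {ω₂ lam β γ : ℝ} (hω : 0 < ω₂) (hl : 0 ≤ lam) (hβ : 0 ≤ β) (hγ : 0 ≤ γ) (N : ℕ)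
  (T_L T_R : ℝ)

include hω hl hβ hγ

/-- `x ↦ ∂_z E(z, r, x)[v]` is `C^∞` in the skeleton (joint smoothness of the flow map in
(start, skeleton): R `contDiff_skelFlowMapAt_uncurry`; a GENUINE derivative). [folklore] -/
theorem contDiff_fderiv_skelFlowMapAt_left_apply {s : ℝ} (hs : s ∈ Icc (0 : ℝ) 1) (m : ℕ)
    (z : PhaseSpace N) (r : WienerPair) (v : PhaseSpace N) :
    ContDiff ℝ ∞ fun x : PairSkeleton m =>
      fderiv ℝ (fun z' => skelFlowMapAt ω₂ lam β γ N T_L T_R s m z' r x) z v := by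
  have hu0 := (contDiff_skelFlowMapAt_uncurry hω hl hβ hγ N T_L T_R hs m r).comp
    ((contDiff_snd (𝕜 := ℝ) (E := PairSkeleton m) (F := PhaseSpace N) (n := ∞)).prodMk
      contDiff_fst)
  have hfun : (Function.uncurry fun (x : PairSkeleton m) (z' : PhaseSpace N) =>
      skelFlowMapAt ω₂ lam β γ N T_L T_R s m z' r x) =
      (fun p : PhaseSpace N × PairSkeleton m => skelFlowMapAt ω₂ lam β γ N T_L T_R s m p.1 r p.2) ∘
        fun p : PairSkeleton m × PhaseSpace N => (p.2, p.1) := rfl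
  have hu : ContDiff ℝ ∞ (Function.uncurry fun (x : PairSkeleton m) (z' : PhaseSpace N) =>
      skelFlowMapAt ω₂ lam β γ N T_L T_R s m z' r x) := by
    rw [hfun]; exact hu0
  have h1 : ContDiff ℝ ∞ fun x : PairSkeleton m =>
      fderiv ℝ (fun z' => skelFlowMapAt ω₂ lam β γ N T_L T_R s m z' r x) z :=
    hu.fderiv (contDiff_const (c := z)) (by simp)
  exact h1.clm_apply contDiff_const

/-- `(z, (x, r)) ↦ ∂_z E(z, r, x)[v]` is jointly measurable in (start, skeleton, remainder)
(difference quotients of the jointly measurable flow map, `measurable_fderiv_apply_of_param`).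
[folklore] -/
theorem measurable_fderiv_skelFlowMapAt_left_uncurry {s : ℝ} (hs : s ∈ Icc (0 : ℝ) 1) (m : ℕ)
    (v : PhaseSpace N) :
    Measurable fun q : PhaseSpace N × (PairSkeleton m × WienerPair) =>
      fderiv ℝ (fun y : PhaseSpace N => skelFlowMapAt ω₂ lam β γ N T_L T_R s m y q.2.2 q.2.1) q.1
        v := by
  have hF := measurable_skelFlowMapAt_uncurry hω hl hβ hγ N T_L T_R s m
  have hd : ∀ (rx : PairSkeleton m × WienerPair) (z' : PhaseSpace N),
      DifferentiableAt ℝ (fun y : PhaseSpace N =>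
        skelFlowMapAt ω₂ lam β γ N T_L T_R s m y rx.2 rx.1) z' := fun rx z' =>
    (contDiff_skelFlowMapAt_left hω hl hβ hγ N T_L T_R hs m rx.2 rx.1).differentiable (by simp) z'
  exact measurable_fderiv_apply_of_param
    (fun q : PhaseSpace N × (PairSkeleton m × WienerPair) =>
      skelFlowMapAt ω₂ lam β γ N T_L T_R s m q.1 q.2.2 q.2.1) hF hd _

/-- `(x, r) ↦ ∂_z E(z, r, x)[v]` is jointly measurable in (skeleton, remainder). [folklore] -/
theorem measurable_fderiv_skelFlowMapAt_left_apply {s : ℝ} (hs : s ∈ Icc (0 : ℝ) 1) (m : ℕ)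
    (z v : PhaseSpace N) :
    Measurable fun p : PairSkeleton m × WienerPair =>
      fderiv ℝ (fun y : PhaseSpace N => skelFlowMapAt ω₂ lam β γ N T_L T_R s m y p.2 p.1) z v := by
  have hι : Measurable fun p : PairSkeleton m × WienerPair =>
      ((z, p) : PhaseSpace N × (PairSkeleton m × WienerPair)) :=
    measurable_const.prodMk measurable_id
  have h2 := (measurable_fderiv_skelFlowMapAt_left_uncurry hω hl hβ hγ N T_L T_R hs m v).comp hι
  exact h2

/-- The mixed variation `∂_δ ∂_z E[v]` is jointly measurable in (skeleton, remainder). [folklore] -/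
theorem measurable_fderiv_fderiv_skelFlowMapAt_mixed_apply {s : ℝ} (hs : s ∈ Icc (0 : ℝ) 1)
    (m : ℕ) (z v : PhaseSpace N) (δ : PairSkeleton m) :
    Measurable fun p : PairSkeleton m × WienerPair => fderiv ℝ (fun y => fderiv ℝ
      (fun z' => skelFlowMapAt ω₂ lam β γ N T_L T_R s m z' p.2 y) z v) p.1 δ := by
  have hF := measurable_fderiv_skelFlowMapAt_left_apply hω hl hβ hγ N T_L T_R hs m z v
  have hd : ∀ (r : WienerPair) (x : PairSkeleton m), DifferentiableAt ℝ (fun y => fderiv ℝ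
      (fun z' => skelFlowMapAt ω₂ lam β γ N T_L T_R s m z' r y) z v) x := fun r x =>
    (contDiff_fderiv_skelFlowMapAt_left_apply hω hl hβ hγ N T_L T_R hs m z r v).differentiable
      (by simp) x
  exact measurable_fderiv_apply_of_param
    (fun p : PairSkeleton m × WienerPair => fderiv ℝ
      (fun z' => skelFlowMapAt ω₂ lam β γ N T_L T_R s m z' p.2 p.1) z v) hF hd δ

/-! ## 5. Pointwise sizes of the departure data -/

omit hω hl hβ hγ in
/-- `Σ_a |V_a(x)| ≤ 2N ‖∂_z E(x)[(0,e_b)]‖`. [folklore] -/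
theorem sum_abs_skelDepVec_le (s : ℝ) (m : ℕ) (b : Fin N) (z : PhaseSpace N) (r : WienerPair)
    (x : PairSkeleton m) :
    ∑ a, |skelDepVec ω₂ lam β γ N T_L T_R s m b z r x a| ≤
      (Fintype.card (Fin N ⊕ Fin N) : ℝ) *
        ‖fderiv ℝ (fun z' => skelFlowMapAt ω₂ lam β γ N T_L T_R s m z' r x) z
          ((0 : Fin N → ℝ), Pi.single b 1)‖ :=
  sum_abs_coordV_le_card_mul_norm _

/-- `|∂_v V_k(x)| ≤ ‖∂_v ∂_z E(x)[(0,e_b)]‖` (the derivative commutes with the coordinate map).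
[folklore] -/
theorem abs_fderiv_skelDepVec_apply_le {s : ℝ} (hs : s ∈ Icc (0 : ℝ) 1) (m : ℕ) (b : Fin N)
    (z : PhaseSpace N) (r : WienerPair) (x v : PairSkeleton m) (k : Fin N ⊕ Fin N) :
    |fderiv ℝ (fun y => skelDepVec ω₂ lam β γ N T_L T_R s m b z r y k) x v| ≤
      ‖fderiv ℝ (fun y => fderiv ℝ (fun z' => skelFlowMapAt ω₂ lam β γ N T_L T_R s m z' r y) z
        ((0 : Fin N → ℝ), Pi.single b 1)) x v‖ := by
  have hG := (contDiff_fderiv_skelFlowMapAt_left_apply hω hl hβ hγ N T_L T_R hs m z r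
    ((0 : Fin N → ℝ), Pi.single b 1)).differentiable (by simp) x
  have hfun : (fun y => skelDepVec ω₂ lam β γ N T_L T_R s m b z r y k) = fun y =>
      coordV N (fderiv ℝ (fun z' => skelFlowMapAt ω₂ lam β γ N T_L T_R s m z' r y) z
        ((0 : Fin N → ℝ), Pi.single b 1)) k := rfl
  rw [hfun, fderiv_coordV_comp hG k v]
  exact abs_coordV_apply_le_norm _ _

omit hω hl hβ hγ in
/-- **Departure field size**: `|u^dep_j(x)| ≤ 2N κ⁻¹ (2N ‖∂_zE(0,e_b)‖) ‖DE b_j‖`. [folklore] -/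
theorem abs_skelFieldDep_le (s : ℝ) (m : ℕ) {κ : ℝ} (hκ : 0 < κ) (b : Fin N) (z : PhaseSpace N)
    (r : WienerPair) (x : PairSkeleton m) (j : Fin (2 ^ m) ⊕ Fin (2 ^ m)) :
    |skelFieldDep ω₂ lam β γ N T_L T_R s m κ b z r x j| ≤
      (Fintype.card (Fin N ⊕ Fin N) : ℝ) * (κ⁻¹ * ((Fintype.card (Fin N ⊕ Fin N) : ℝ) *
        ‖fderiv ℝ (fun z' => skelFlowMapAt ω₂ lam β γ N T_L T_R s m z' r x) z
          ((0 : Fin N → ℝ), Pi.single b 1)‖)) *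
        ‖fderiv ℝ (skelFlowMapAt ω₂ lam β γ N T_L T_R s m z r) x (basisX m j)‖ := by
  rw [skelFieldDep_eq_skelFieldGen]
  have h := abs_skelFieldGen_le (ω₂ := ω₂) (lam := lam) (β := β) (γ := γ) N T_L T_R s m hκ z r
    (skelDepVec ω₂ lam β γ N T_L T_R s m b z r) x j
  have hZ := sum_abs_skelDepVec_le (ω₂ := ω₂) (lam := lam) (β := β) (γ := γ) N T_L T_R s m b z r x
  exact h.trans (mul_le_mul_of_nonneg_right (mul_le_mul_of_nonneg_left
    (mul_le_mul_of_nonneg_left hZ (inv_nonneg.2 hκ.le)) (Nat.cast_nonneg _)) (norm_nonneg _))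

/-- **Departure field derivative**: with `K = 2N`, `Z = ‖∂_zE(0,e_b)‖`, `Mx = ‖∂_v∂_zE(0,e_b)‖`,
`F_l = ‖DE b_l‖`, `S_l = ‖∂_v DE b_l‖`:
`|∂_v u^dep_j| ≤ K((κ⁻¹KZ)S_j + F_j(κ⁻¹(K·Mx + (κ⁻¹KZ)(K²·2·2^{-m}Σ_l F_lS_l))))`. [folklore] -/
theorem abs_fderiv_skelFieldDep_le {s : ℝ} (hs : s ∈ Icc (0 : ℝ) 1) (m : ℕ) {κ : ℝ} (hκ : 0 < κ)
    (b : Fin N) (z : PhaseSpace N) (r : WienerPair) (x v : PairSkeleton m)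
    (j : Fin (2 ^ m) ⊕ Fin (2 ^ m)) :
    |fderiv ℝ (fun y => skelFieldDep ω₂ lam β γ N T_L T_R s m κ b z r y j) x v| ≤
      (Fintype.card (Fin N ⊕ Fin N) : ℝ) *
        ((κ⁻¹ * ((Fintype.card (Fin N ⊕ Fin N) : ℝ) *
            ‖fderiv ℝ (fun z' => skelFlowMapAt ω₂ lam β γ N T_L T_R s m z' r x) z
              ((0 : Fin N → ℝ), Pi.single b 1)‖)) *
            ‖fderiv ℝ (fun y => fderiv ℝ (skelFlowMapAt ω₂ lam β γ N T_L T_R s m z r) y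
              (basisX m j)) x v‖ +
          ‖fderiv ℝ (skelFlowMapAt ω₂ lam β γ N T_L T_R s m z r) x (basisX m j)‖ *
            (κ⁻¹ * ((Fintype.card (Fin N ⊕ Fin N) : ℝ) *
              ‖fderiv ℝ (fun y => fderiv ℝ (fun z' => skelFlowMapAt ω₂ lam β γ N T_L T_R s m z' r y)
                z ((0 : Fin N → ℝ), Pi.single b 1)) x v‖ +
              (κ⁻¹ * ((Fintype.card (Fin N ⊕ Fin N) : ℝ) *
                ‖fderiv ℝ (fun z' => skelFlowMapAt ω₂ lam β γ N T_L T_R s m z' r x) z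
                  ((0 : Fin N → ℝ), Pi.single b 1)‖)) *
              ((Fintype.card (Fin N ⊕ Fin N) : ℝ) ^ 2 * (2 * (((2 : ℝ) ^ m)⁻¹ *
                ∑ l, ‖fderiv ℝ (skelFlowMapAt ω₂ lam β γ N T_L T_R s m z r) x (basisX m l)‖ *
                  ‖fderiv ℝ (fun y => fderiv ℝ (skelFlowMapAt ω₂ lam β γ N T_L T_R s m z r) y
                    (basisX m l)) x v‖)))))) := by
  have hfun : (fun y => skelFieldDep ω₂ lam β γ N T_L T_R s m κ b z r y j) = fun y =>
      skelFieldGen ω₂ lam β γ N T_L T_R s m κ z r (skelDepVec ω₂ lam β γ N T_L T_R s m b z r) y j :=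
    rfl
  have he : ∀ a, Differentiable ℝ fun y => skelDepVec ω₂ lam β γ N T_L T_R s m b z r y a :=
    fun a => (contDiff_skelDepVec_apply hω hl hβ hγ N T_L T_R hs m b z r a).differentiable (by simp)
  have h := abs_fderiv_skelFieldGen_le hω hl hβ hγ N T_L T_R hs m hκ z r he x v j
  have hZ := sum_abs_skelDepVec_le (ω₂ := ω₂) (lam := lam) (β := β) (γ := γ) N T_L T_R s m b z r x
  have hM : ∑ k, |fderiv ℝ (fun y => skelDepVec ω₂ lam β γ N T_L T_R s m b z r y k) x v| ≤
      (Fintype.card (Fin N ⊕ Fin N) : ℝ) *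
        ‖fderiv ℝ (fun y => fderiv ℝ (fun z' => skelFlowMapAt ω₂ lam β γ N T_L T_R s m z' r y)
          z ((0 : Fin N → ℝ), Pi.single b 1)) x v‖ := by
    calc _ ≤ ∑ _k : Fin N ⊕ Fin N, ‖fderiv ℝ (fun y => fderiv ℝ
          (fun z' => skelFlowMapAt ω₂ lam β γ N T_L T_R s m z' r y) z
            ((0 : Fin N → ℝ), Pi.single b 1)) x v‖ :=
          Finset.sum_le_sum fun k _ =>
            abs_fderiv_skelDepVec_apply_le hω hl hβ hγ N T_L T_R hs m b z r x v k
      _ = _ := by rw [Finset.sum_const, Finset.card_univ, nsmul_eq_mul]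
  have hK0 : 0 ≤ (Fintype.card (Fin N ⊕ Fin N) : ℝ) := Nat.cast_nonneg _
  have hκ0 : 0 ≤ κ⁻¹ := inv_nonneg.2 hκ.le
  have hR0 : 0 ≤ (Fintype.card (Fin N ⊕ Fin N) : ℝ) ^ 2 * (2 * (((2 : ℝ) ^ m)⁻¹ *
      ∑ l, ‖fderiv ℝ (skelFlowMapAt ω₂ lam β γ N T_L T_R s m z r) x (basisX m l)‖ *
        ‖fderiv ℝ (fun y => fderiv ℝ (skelFlowMapAt ω₂ lam β γ N T_L T_R s m z r) y
          (basisX m l)) x v‖)) := by positivity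
  rw [hfun]
  refine h.trans (mul_le_mul_of_nonneg_left (add_le_add
    (mul_le_mul_of_nonneg_right (mul_le_mul_of_nonneg_left hZ hκ0) (norm_nonneg _))
    (mul_le_mul_of_nonneg_left (mul_le_mul_of_nonneg_left (add_le_add hM
      (mul_le_mul_of_nonneg_right (mul_le_mul_of_nonneg_left hZ hκ0) hR0)) hκ0) (norm_nonneg _)))
    hK0)

end DepReg

end Summit.AtomisticToContinuum.FouriersLaw.Theorems.ExtensiveSnapshotIrreversibility.EnergyWindow

end
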